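import Summits.ABC.IUTFork.Cor312RegimeVerbatimPrVolExact
import HarnessLib

/-!
# [IUTchIII] Cor. 3.12 — the regime decomposition at the print-normalised sharp setting of record, VII: the Θ-volume of the
# TRIVIAL configuration is a FINITE SUM over the primes `2` and `p | disc F` of the local terms of the unit boxes

PROOF-ONLY support piece of the abc-iut cell (Cor. 3.12 cone, D-0067; seat abc-iut-w4-d107, gen 5; part 20 of the
`Cor312NegLogThetaUpperPrVol*` / `Cor312RegimeVerbatimPrVol*` chain, companion of parts 11–15 and 18; K/F-level twin of the
M-level `negLogTheta_settingPrVolSharpM_trivial_eq_sum` of part 19). TAKES NO SIDE on [IUTchIII] Cor. 3.12; theorems only,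
0 `def`s, no new `Prop` fact, no instance.

* **`negLogTheta_settingPrVolSharp_trivial_eq_sum`** — for EVERY pilot datum `X` (no hypothesis on `S`), every context and any
  finite set `Bad` of primes containing `2` and the primes dividing `disc(F)`:
  `−|log(Θ)|(𝟙) = PN_i Σ_{p∈Bad} −|log(Θ)|_{i+1,p}(𝟙)` EXACTLY — at every odd prime `p ∤ disc(F)` the local term of the unit
  boxes is `0` (abc-iut-c312-5's exact value at the zero exponents, part 11 `thetaLocal_untopD_settingPrVolSharp_trivial_eq_zero`),
  at `∞` it is `0` (trivial archimedean container). So the one datum-independent number of parts 11–18 is a finite sum of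
  unit-box hull inflations at the dyadic and ramified packets, each `≥ 0` (part 13/18) and `> 0` at a packet over a prime with
  a place of ramification index `≥ 2` (part 18).
HONEST SCOPE as in parts 7–19; nothing here asserts or denies [IUTchIII] Cor. 3.12 for initial Θ-data. typed ≠ proved;
instantiated ≠ endorsed. [claim: Mochizuki2012, status: disputed] [cite: DupuyHilado2025, §3.6, §3.9, §4.9]
[cite: Mochizuki2012, IUTchIV Thm 1.10 proof Step (vi) p. 29]
-/

noncomputable section

open Set Function NumberField IsDedekindDomain
open scoped Pointwise

namespace Summit.ABC

namespace IUTFork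

namespace Thm311

namespace Real

open Cor312 Cor312.Setting Cor312Vol Literature.IUT.LogThetaLattice Literature.IUT.LogVolume

variable {F : Type} [Field F] [NumberField F] (X : PilotData F) {logv : PadicLogs F} (hlog : LogvAnalytic logv)

variable (M : Type) [Field M] [NumberField M]
  (archPk : ∀ (j : (thetaIndex X).Label) (vQ : (thetaIndex X).VQ), Set ((logShellsDH X logv).Packet j vQ))
  (archSub : ∀ (j : (thetaIndex X).Label) (v : (thetaIndex X).V),
    Set ((logShellsDH X logv).Packet j ((thetaIndex X).over v)))
  (Ψ : ℤ → ∀ v : (thetaIndex X).V, v ∈ (thetaIndex X).Vbad → Set ((logShellsDH X logv).StarPacket v))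
  (act : ℤ → ∀ v : (thetaIndex X).V, v ∈ (thetaIndex X).Vbad →
    (logShellsDH X logv).StarPacket v → Module.End ℚ ((logShellsDH X logv).StarPacket v))
  (Mmod : ℤ → ∀ j : (thetaIndex X).LabelStar, Set ((logShellsDH X logv).GlobalPacket j.1))
  (region : ℤ → ∀ j : (thetaIndex X).LabelStar, FinDivisor M → ∀ vQ : (thetaIndex X).VQ,
    Set ((logShellsDH X logv).Packet j.1 vQ))
  (n : ℤ) {HT : Type} {LogLink : HT → HT → Type} {IsFull : ∀ {s t : HT}, LogLink s t → Prop}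
  (lat : LGPGaussianLogThetaLattice LogLink IsFull)
  {Frd : Type} {IsoF : Frd → Frd → Type} {Ob : Frd → Type} {realify : Frd → Frd} {Strip : Type}
  {IsoS : Strip → Strip → Type} {Mv : ∀ v : (thetaIndex X).V, v ∈ (thetaIndex X).Vbad → Type}
  [∀ v h, Monoid (Mv v h)]
  (sig : GlobalLGPFrobenioidSignature (thetaIndex X).lstar (thetaIndex X).V (· ∈ (thetaIndex X).Vbad)
    Frd IsoF Ob realify Strip IsoS Mv)
  (split : SplittingMonoids Mv) {ObΔ : Type} {N : ∀ v : (thetaIndex X).V, v ∈ (thetaIndex X).Vbad → Type}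
  [∀ v h, Monoid (N v h)] (qData : QPilotData ObΔ N)

/-- **`−|log(Θ)|(𝟙)` IS A FINITE SUM OVER THE EXCEPTIONAL PRIMES.** For every pilot datum `X` (no hypothesis on `S`), every
context and any finite set `Bad ⊇ {2} ∪ {p | disc F}` of primes:
`−|log(Θ)|(𝟙) = PN_i Σ_{p∈Bad} −|log(Θ)|_{i+1,p}(𝟙)` — the local terms of the unit boxes vanish at every odd prime `p ∤ disc(F)`
(part 11, abc-iut-c312-5's exact value at the zero exponents) and at `∞`. [cite: DupuyHilado2025, §3.6, §3.9]
[cite: Mochizuki2012, IUTchIV Thm 1.10 proof Step (vi) p. 29] [claim: Mochizuki2012, status: disputed] -/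
theorem negLogTheta_settingPrVolSharp_trivial_eq_sum (Bad : Finset Nat.Primes)
    (hBad2 : ∀ pp : Nat.Primes, (pp : ℕ) ≤ 2 → pp ∈ Bad)
    (hBadD : ∀ pp : Nat.Primes, ((pp : ℕ) : ℤ) ∣ NumberField.discr F → pp ∈ Bad) :
    (settingPrVolSharp X hlog M archPk archSub Ψ act Mmod region n lat sig split qData (fun _ _ => 1) (fun _ _ _ => 1)
        (fun _ _ => one_ne_zero) (fun _ _ _ => norm_one)).negLogTheta =
      ((processionNormalized (fun i : Fin (thetaIndex X).lstar => ∑ pp ∈ Bad,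
          ((settingPrVolSharp X hlog M archPk archSub Ψ act Mmod region n lat sig split qData (fun _ _ => 1)
            (fun _ _ _ => 1) (fun _ _ => one_ne_zero) (fun _ _ _ => norm_one)).thetaLocal (Setting.labelSucc i)
              (.inr pp)).untopD 0) : ℝ) : WithTop ℝ) := by
  have hfinΘ₁ := thetaFinite_settingPrVolSharp X hlog M archPk archSub Ψ act Mmod region n lat sig split qData
    (fun _ _ _ => 1) (fun _ _ => 1) (fun _ _ _ => one_ne_zero) (fun _ _ _ _ => norm_one) (fun _ _ => one_ne_zero)
    (fun _ _ _ => norm_one)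
  have H₁ := bridgeHyps_settingPrVolSharp_of_ideles X hlog M archPk archSub Ψ act Mmod region n lat sig split qData
    (fun _ _ _ => 1) (fun _ _ => 1) (fun _ _ _ => one_ne_zero) (fun _ _ _ _ => norm_one) (fun _ _ => one_ne_zero)
    (fun _ _ _ => norm_one)
  unfold Setting.negLogTheta
  rw [if_pos hfinΘ₁, WithTop.coe_inj]
  refine congrArg processionNormalized (funext fun i => ?_)
  set f1 : (thetaIndex X).VQ → ℝ := fun vQ =>
    ((settingPrVolSharp X hlog M archPk archSub Ψ act Mmod region n lat sig split qData (fun _ _ => 1) (fun _ _ _ => 1)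
      (fun _ _ => one_ne_zero) (fun _ _ _ => norm_one)).thetaLocal (Setting.labelSucc i) vQ).untopD 0 with hf1
  have hsupp : (Function.support f1) ⊆
      ((Bad.map ⟨(Sum.inr : Nat.Primes → (thetaIndex X).VQ), fun _ _ h => Sum.inr_injective h⟩ :
        Finset (thetaIndex X).VQ) : Set (thetaIndex X).VQ) := by
    intro vQ hvQ
    rw [Function.mem_support] at hvQ
    rcases vQ with u | pp
    · refine absurd ?_ hvQ
      show f1 (.inl u) = 0
      rw [hf1]
      exact thetaLocal_settingPrVol_untopD_inl X hlog M archPk archSub Ψ act Mmod region n lat sig split qData _ _ _ _ u i H₁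
    · rw [Finset.coe_map, Set.mem_image]
      by_cases hpp : pp ∈ Bad
      · exact ⟨pp, Finset.mem_coe.mpr hpp, rfl⟩
      · refine absurd ?_ hvQ
        have hp2 : 2 < (pp : ℕ) := by
          by_contra h; exact hpp (hBad2 pp (not_lt.mp h))
        have hdisc : ¬ ((pp : ℕ) : ℤ) ∣ NumberField.discr F := fun h => hpp (hBadD pp h)
        show f1 (.inr pp) = 0
        rw [hf1]
        exact thetaLocal_untopD_settingPrVolSharp_trivial_eq_zero X hlog M archPk archSub Ψ act Mmod region n lat sig split
          qData i pp hp2 hdisc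
  show ∑ᶠ vQ, f1 vQ = ∑ pp ∈ Bad, f1 (.inr pp)
  rw [finsum_eq_sum_of_support_subset f1 hsupp, Finset.sum_map]
  rfl

end Real

end Thm311

end IUTFork

end Summit.ABC

end
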